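import Mathlib
import Literature.Combinatorics.Optimization.MaxCutSdpHardness
import Literature.Combinatorics.Optimization.LpRelaxationsVersusSheraliAdamsProof
import Literature.Combinatorics.Optimization.MaxThreeSatLpLowerBound
import HarnessLib

/-!
# MaxCUT as a Max-CSP: unconditional SDP and LP approximation hardness via the Max-3-XOR gadget reduction

Companion of `MaxCutSdpHardness.lean` (Braun–Pokutta–Roy 2016 §7, Thm. 7.1, via the
Trevisan–Sorkin–Sudan–Williamson cut gadgets) in the tree's NATIVE Max-CSP vocabulary of
Lee–Raghavendra–Steurer 2015 / Kothari–Meka–Raghavendra 2017 (`SDPRelaxationsMaxCSP.lean`,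
`LPRelaxationsMaxCSP.lean`): "Max Cut corresponds to the case where `𝒫` consists of the binary
inequality predicate" [cite: LeeRaghavendraSteurer2015, §1.2 (p. 6)] — `maxCutPreds`, instances = lists of
constraints `x_u ≠ x_v` with multiplicity (multigraphs, as in the tree's KMR Cor. 1.5 Max-Cut clause), so the
weighted-graph caveat of `MaxCutSdpHardness.lean` disappears here.  All PROVED, no named facts:

* `cutCsp I` — the Max-3-XOR instance `𝔍` on `n` variables (the tree's Max-`literalClosure (xorK 3)`)
  mapped to the Max-Cut instance `𝔍*` on `N = |CutVertex n| = 1 + 2n + 36n³` variables listing every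
  gadget edge of `MaxCutSdpHardness.cutInst I` as a `≠`-constraint (the weight-`2` edge twice):
  `𝔍*(y) = val_{𝔍*}(y)/(42M)` (`cutCsp_val`), hence `𝔍*(x*) = (30 + 4·𝔍(x))/42` and
  `opt(𝔍) ≤ s ⇒ opt(𝔍*) ≤ (15 + 2s)/21` — the reduction of
  [cite: BraunPokuttaRoy2016, §7, proof of Thm. 7.1 (arXiv v3)] with both parities (see that file's docstring
  for the repair of the printed `15/16`), [cite: TrevisanEtAl2000, Lemma 4.3 (8- and 9-gadgets)].
* `xorCutCspReduction` — the same as a Braun–Pokutta–Roy reduction between the two Max-CSPs seen as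
  maximization problems (`cspProblem`), affine with the constant `M₁ ≡ 21/2`.
* **SDP (LRS Thm. 1.5 shape for Max Cut):** `maxCut_subspace_quasipoly` — there is `γ > 0` such that for all
  `1/2 < s < c < 1` and all large `n`, no subspace `U` of functions on `{0,1}^N`, `N = 1 + 2n + 36n³`, with
  `dim U ≤ N^{γ log N/log log N}` achieves a `((15+2c)/21, (15+2s)/21)`-approximation for Max-Cut on `N`
  variables (from the tree's `LeeRaghavendraSteurer2015_maxKXor_quasipoly` and Prop. 1.13); with
  `c = 1 − ε`, `s = 1/2 + δ` the pair is `((17−2ε)/21, (16+2δ)/21)`, ratio `→ 16/17`.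
* **LP (unconditional):** `LPRelaxation.pullback` — LP relaxations (KMR Def. 1.1) travel along CSP
  reductions with an affine value relation, at the cost of `+2` inequalities (one extra coordinate pinned to
  `1`) [cite: BraunPokuttaZink2015, Def. 4.1 / Prop. 4.2 (LP clause)]; hence `maxCut_poly_lp`: for every
  `ε > 0` and `C`, for all large `n`, no LP relaxation of Max-Cut on `N = 1 + 2n + 36n³` variables of size
  `≤ N^C` achieves a `((17−2ε)/21, (16+2ε)/21)`-approximation — UNCONDITIONAL (input: the tree's
  `maxKXor_poly_lp` = Chan–Lee–Raghavendra–Steurer Thm. 3.1 × Schoenebeck), to be compared with the tree's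
  `maxCut_poly_lp_of_CMM` (`(1−ε, 1/2+ε)`, conditional on the Charikar–Makarychev–Makarychev SA gap) and
  with [cite: BraunPokuttaZink2015, Thm. 4.5] (`fc(MaxCUT, 1−ε, 1/2+ε) ≥ n^{Ω(log n/log log n)}` via [CMM09]);
  and the integrality-gap form `maxCut_poly_lpGap` (no gap `< 17/16 − ε`).
-/

noncomputable section

open Finset Matrix Real Filter

namespace Literature.Combinatorics.Optimization

/-! ### LP relaxations travel along CSP reductions (Braun–Pokutta–Zink, LP clause) -/

namespace LPRelaxation

variable {k₁ k₂ n N R : ℕ} {P₁ : Set ((Fin k₁ → Bool) → Bool)} {P₂ : Set ((Fin k₂ → Bool) → Bool)}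

/-- The polytope of the pulled-back relaxation: `A y ≤ b` on the first `D` coordinates, last coordinate
pinned to `1` (two inequalities). [cite: BraunPokuttaZink2015, Prop. 4.2 (LP clause, proof)] -/
def pullbackA (L : LPRelaxation k₂ N P₂ R) : Matrix (Fin (R + 2)) (Fin (L.D + 1)) ℝ :=
  Matrix.of fun i j =>
    Fin.addCases (motive := fun _ => ℝ)
      (fun i' : Fin R => Fin.lastCases (motive := fun _ => ℝ) 0 (fun j' => L.A i' j') j)
      (fun i' : Fin 2 => Fin.lastCases (motive := fun _ => ℝ) (if i' = 0 then 1 else -1) (fun _ => 0) j) i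

/-- Right-hand side of the pulled-back relaxation. [cite: BraunPokuttaZink2015, Prop. 4.2 (LP clause, proof)] -/
def pullbackB (L : LPRelaxation k₂ N P₂ R) : Fin (R + 2) → ℝ :=
  Fin.addCases (fun i' : Fin R => L.b i') (fun i' : Fin 2 => if i' = 0 then 1 else -1)

/-- `A' (y, t)` on an original row is `A y`. [cite: BraunPokuttaZink2015, Prop. 4.2 (LP clause, proof)] -/
theorem pullbackA_mulVec_castAdd (L : LPRelaxation k₂ N P₂ R) (y : Fin (L.D + 1) → ℝ) (i : Fin R) :
    (L.pullbackA *ᵥ y) (Fin.castAdd 2 i) = (L.A *ᵥ fun j => y (Fin.castSucc j)) i := by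
  simp only [mulVec, dotProduct, pullbackA, of_apply, Fin.addCases_left]
  rw [Fin.sum_univ_castSucc]
  simp only [Fin.lastCases_castSucc, Fin.lastCases_last, zero_mul, add_zero]

/-- `A' (y, t)` on the two new rows is `t` resp. `−t`. [cite: BraunPokuttaZink2015, Prop. 4.2 (LP clause, proof)] -/
theorem pullbackA_mulVec_natAdd (L : LPRelaxation k₂ N P₂ R) (y : Fin (L.D + 1) → ℝ) (i : Fin 2) :
    (L.pullbackA *ᵥ y) (Fin.natAdd R i) = (if i = 0 then 1 else -1) * y (Fin.last L.D) := by
  simp only [mulVec, dotProduct, pullbackA, of_apply, Fin.addCases_right]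
  rw [Fin.sum_univ_castSucc]
  simp only [Fin.lastCases_castSucc, Fin.lastCases_last, zero_mul, sum_const_zero, zero_add]

/-- Membership in the pulled-back polytope: `(y, t) ∈ 𝒫'` iff `y ∈ 𝒫` and `t = 1`.
[cite: BraunPokuttaZink2015, Prop. 4.2 (LP clause, proof)] -/
theorem pullback_mem_iff (L : LPRelaxation k₂ N P₂ R) (y : Fin (L.D + 1) → ℝ) :
    (∀ i, (L.pullbackA *ᵥ y) i ≤ L.pullbackB i) ↔
      (fun j => y (Fin.castSucc j)) ∈ L.polytope ∧ y (Fin.last L.D) = 1 := by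
  constructor
  · intro h
    refine ⟨fun i => ?_, ?_⟩
    · have := h (Fin.castAdd 2 i)
      rwa [pullbackA_mulVec_castAdd, pullbackB, Fin.addCases_left] at this
    · have h0 := h (Fin.natAdd R 0)
      have h1 := h (Fin.natAdd R 1)
      rw [pullbackA_mulVec_natAdd, pullbackB, Fin.addCases_right] at h0 h1
      simp only [if_true, one_mul] at h0
      simp only [show (1 : Fin 2) ≠ 0 by decide, if_false, neg_mul, one_mul, neg_le_neg_iff] at h1
      exact le_antisymm h0 h1
  · rintro ⟨hy, ht⟩ i
    refine Fin.addCases (fun i' => ?_) (fun i' => ?_) i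
    · rw [pullbackA_mulVec_castAdd, pullbackB, Fin.addCases_left]; exact hy i'
    · rw [pullbackA_mulVec_natAdd, pullbackB, Fin.addCases_right, ht, mul_one]

/-- **Pull-back of an LP relaxation along a CSP reduction.**  Given maps `𝔍 ↦ 𝔍*` (instances of
Max-`𝒫₁` on `n` variables to instances of Max-`𝒫₂` on `N` variables) and `x ↦ x*` (assignments) with an
affine value relation `𝔍(x) = a·𝔍*(x*) + θ`, an LP relaxation of Max-`𝒫₂` on `N` variables of size `R`
(`v_y`, `w_𝔍`, `A y ≤ b`) yields one of Max-`𝒫₁` on `n` variables of size `R + 2`: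
`v'_x = (v_{x*}, 1)`, `w'_𝔍 = (a·w_{𝔍*}, θ)`, polytope `𝒫 × {1}`.
[cite: BraunPokuttaZink2015, Def. 4.1 and Prop. 4.2 (LP clause)] [cite: KothariMekaRaghavendra2017, Def. 1.1 (p. 3)] -/
def pullback (L : LPRelaxation k₂ N P₂ R) (inst : CSPInstance k₁ n P₁ → CSPInstance k₂ N P₂)
    (sol : (Fin n → Bool) → (Fin N → Bool)) (a θ : ℝ)
    (hval : ∀ (I : CSPInstance k₁ n P₁) (x : Fin n → Bool), I.val x = a * (inst I).val (sol x) + θ) :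
    LPRelaxation k₁ n P₁ (R + 2) where
  D := L.D + 1
  v x := Fin.snoc (L.v (sol x)) 1
  w I := Fin.snoc (a • L.w (inst I)) θ
  exact I x := by
    rw [hval I x, L.exact, dotProduct, dotProduct, Fin.sum_univ_castSucc]
    simp only [Fin.snoc_castSucc, Fin.snoc_last, Pi.smul_apply, smul_eq_mul, mul_one, mul_sum, mul_assoc]
  A := L.pullbackA
  b := L.pullbackB
  mem x := (L.pullback_mem_iff _).2 ⟨fun i => by simpa using L.mem (sol x) i, by simp⟩
  bounded := by
    rw [← Bornology.forall_isBounded_image_eval_iff]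
    intro j
    refine Fin.lastCases ?_ (fun j' => ?_) j
    · refine (Bornology.isBounded_singleton (x := (1 : ℝ))).subset ?_
      rintro _ ⟨y, hy, rfl⟩
      exact ((L.pullback_mem_iff y).1 hy).2
    · have hb := (Bornology.forall_isBounded_image_eval_iff.2 L.bounded) j'
      refine hb.subset ?_
      rintro _ ⟨y, hy, rfl⟩
      exact ⟨fun j => y (Fin.castSucc j), ((L.pullback_mem_iff y).1 hy).1, rfl⟩

/-- The pulled-back relaxation achieves `(c₁, s₁)` whenever the original achieves `(c₂, s₂)`, provided
`opt(𝔍) ≤ s₁ ⇒ opt(𝔍*) ≤ s₂` and `a·c₂ + θ ≤ c₁`, `a ≥ 0`.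
[cite: BraunPokuttaZink2015, Prop. 4.2 (LP clause)] -/
theorem Achieves.pullback {L : LPRelaxation k₂ N P₂ R} {inst : CSPInstance k₁ n P₁ → CSPInstance k₂ N P₂}
    {sol : (Fin n → Bool) → (Fin N → Bool)} {a θ : ℝ}
    {hval : ∀ (I : CSPInstance k₁ n P₁) (x : Fin n → Bool), I.val x = a * (inst I).val (sol x) + θ}
    {c₁ s₁ c₂ s₂ : ℝ} (h : L.Achieves c₂ s₂) (ha : 0 ≤ a) (hc : a * c₂ + θ ≤ c₁)
    (hsound : ∀ I : CSPInstance k₁ n P₁, I.OptLE s₁ → (inst I).OptLE s₂) :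
    (L.pullback inst sol a θ hval).Achieves c₁ s₁ := by
  intro I hI y hy
  obtain ⟨hy', ht⟩ := (L.pullback_mem_iff y).1 hy
  have hv := h (inst I) (hsound I hI) _ hy'
  change Fin.snoc (a • L.w (inst I)) θ ⬝ᵥ y ≤ c₁
  rw [dotProduct, Fin.sum_univ_castSucc]
  simp only [Fin.snoc_castSucc, Fin.snoc_last, Pi.smul_apply, smul_eq_mul, ht, mul_one]
  have : ∑ j : Fin L.D, a * L.w (inst I) j * y (Fin.castSucc j) = a * (L.w (inst I) ⬝ᵥ fun j => y (Fin.castSucc j)) := by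
    rw [dotProduct, mul_sum]
    exact sum_congr rfl fun j _ => mul_assoc _ _ _
  rw [this]
  nlinarith

end LPRelaxation

/-! ### Max-Cut constraints and the Max-Cut instance `𝔍*` -/

section MaxCutCsp

variable {N : ℕ}

/-- The Max-Cut constraint `x_a ≠ x_b` (`a ≠ b`). [cite: LeeRaghavendraSteurer2015, §1.2 (p. 6, "binary inequality predicate")] -/
def cutConstraint (a b : Fin N) (h : a ≠ b) : CSPConstraint 2 N maxCutPreds where
  pred y := y 0 != y 1
  pred_mem := Set.mem_singleton _
  idx := ⟨![a, b], fun i j hij => by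
    fin_cases i <;> fin_cases j <;> simp_all⟩

/-- `x_a ≠ x_b` is satisfied iff the endpoints get different values.
[cite: LeeRaghavendraSteurer2015, §1.2 (p. 6)] -/
@[simp] theorem cutConstraint_sat (a b : Fin N) (h : a ≠ b) (y : Fin N → Bool) :
    (cutConstraint a b h).sat y = (y a != y b) := rfl

end MaxCutCsp

section Instance

variable {n : ℕ}

/-- The number of Max-Cut variables `N = |CutVertex n| = 1 + 2n + 36n³`.
[cite: BraunPokuttaRoy2016, §7, proof of Thm. 7.1 ("`n = O(m³)`") (arXiv v3)] -/
abbrev cutVars (n : ℕ) : ℕ := Fintype.card (CutVertex n)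

/-- `N = 1 + 2n + 36 n³`. [cite: BraunPokuttaRoy2016, §7 (arXiv v3)] -/
theorem cutVars_eq (n : ℕ) : cutVars n = 1 + 2 * n + 36 * n ^ 3 := CutVertex.card n

/-- A fixed numbering of the Max-Cut vertices. [cite: BraunPokuttaZink2015, Def. 2.4 ("`V(G) = [n]`")] -/
def vertexEquiv (n : ℕ) : CutVertex n ≃ Fin (cutVars n) := Fintype.equivFin (CutVertex n)

/-- A fixed numbering of the `20` gadget edges. [cite: BraunPokuttaRoy2016, §7 ("the `20` edges of every `H(C)`") (arXiv v3)] -/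
def gadgetEnum : Fin 20 ≃ {e // e ∈ gadgetEdges} :=
  (gadgetEdges.equivFin.trans (finCongr card_gadgetEdges)).symm

/-- The index type of the `42` constraints contributed by one Max-3-XOR constraint: `20` core edges of
each of the two gadget copies and the weight-`2` edge `1̂ — 0` of the parity-one copy, twice.
[cite: BraunPokuttaRoy2016, §7 (arXiv v3)] [cite: TrevisanEtAl2000, Lemma 4.3] -/
abbrev SlotIdx : Type := (Bool × Fin 20) ⊕ Fin 2

/-- `|SlotIdx| = 42`. [cite: BraunPokuttaRoy2016, §7 (arXiv v3)] -/
theorem card_slotIdx : Fintype.card SlotIdx = 42 := by simp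

/-- A fixed numbering of `SlotIdx`. [cite: BraunPokuttaRoy2016, §7 (arXiv v3)] -/
def slotEquiv : SlotIdx ≃ Fin 42 := (Fintype.equivFin SlotIdx).trans (finCongr card_slotIdx)

/-- The ordered pair of Max-Cut vertices of the constraint with slot index `j` contributed by the
Max-3-XOR constraint `C`. [cite: BraunPokuttaRoy2016, §7 (arXiv v3)] -/
def slotEdge (C : CSPConstraint 3 n (literalClosure (xorK 3))) : SlotIdx → CutVertex n × CutVertex n
  | Sum.inl (b, j) => Prod.map (gadgetEmb C.idx (XorRhs C) b) (gadgetEmb C.idx (XorRhs C) b) (gadgetEnum j).1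
  | Sum.inr _ => (CutVertex.aux C.idx (XorRhs C) (!XorRhs C) 8, CutVertex.zero)

/-- Slot edges are not loops. [cite: BraunPokuttaRoy2016, Fig. 7.1 (arXiv v3)] -/
theorem slotEdge_ne (C : CSPConstraint 3 n (literalClosure (xorK 3))) (j : SlotIdx) :
    (slotEdge C j).1 ≠ (slotEdge C j).2 := by
  rcases j with ⟨b, j⟩ | j
  · simp only [slotEdge, Prod.map_fst, Prod.map_snd]
    exact fun h => gadgetEdges_ne _ (gadgetEnum j).2 (gadgetEmb_injective _ _ _ h)
  · simp [slotEdge]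

/-- The Max-Cut constraint with slot index `j` contributed by `C`, on the numbered vertices.
[cite: BraunPokuttaRoy2016, §7 (arXiv v3)] -/
def slotConstraint (C : CSPConstraint 3 n (literalClosure (xorK 3))) (j : SlotIdx) :
    CSPConstraint 2 (cutVars n) maxCutPreds :=
  cutConstraint (vertexEquiv n (slotEdge C j).1) (vertexEquiv n (slotEdge C j).2)
    (fun h => slotEdge_ne C j ((vertexEquiv n).injective h))

/-- **The Max-Cut instance `𝔍*` of a Max-3-XOR instance `𝔍`** (as a Max-CSP instance on `N` variables,
`42 M` constraints with multiplicity). [cite: BraunPokuttaRoy2016, §7, proof of Thm. 7.1 (arXiv v3)] -/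
def cutCsp (I : CSPInstance 3 n (literalClosure (xorK 3))) : CSPInstance 2 (cutVars n) maxCutPreds where
  M := I.M * 42
  M_pos := Nat.mul_pos I.M_pos (by norm_num)
  cons p :=
    let q := finProdFinEquiv.symm p
    slotConstraint (I.cons q.1) (slotEquiv.symm q.2)

/-- The solution map `x ↦ x*` on numbered vertices. [cite: BraunPokuttaRoy2016, §7 (arXiv v3)] -/
def cutAssign (x : Fin n → Bool) : Fin (cutVars n) → Bool := canonSide x ∘ (vertexEquiv n).symm

/-- Sum over the `42` slot constraints of one Max-3-XOR constraint = value of the cut on its two gadgets.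
[cite: BraunPokuttaRoy2016, §7 (arXiv v3)] [cite: TrevisanEtAl2000, Lemma 4.3] -/
theorem sum_slot_eq (C : CSPConstraint 3 n (literalClosure (xorK 3))) (X : CutVertex n → Bool) :
    ∑ j : SlotIdx, (if X (slotEdge C j).1 != X (slotEdge C j).2 then (1 : ℝ) else 0) =
      cutValue (gadgetWeight C.idx (XorRhs C) false) X + cutValue (gadgetWeight C.idx (XorRhs C) true) X := by
  -- the doubled edge
  have htwo : ∑ j : Fin 2, (if X (slotEdge C (Sum.inr j)).1 != X (slotEdge C (Sum.inr j)).2 then (1 : ℝ) else 0)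
      = if X (CutVertex.aux C.idx (XorRhs C) (!XorRhs C) 8) ≠ X CutVertex.zero then 2 else 0 := by
    simp only [slotEdge, Fin.sum_univ_two]
    rcases Bool.eq_false_or_eq_true (X (CutVertex.aux C.idx (XorRhs C) (!XorRhs C) 8)) with h8 | h8 <;>
      rcases Bool.eq_false_or_eq_true (X CutVertex.zero) with h0 | h0 <;>
      simp [h8, h0] <;> norm_num
  -- core edges of copy `b`
  have hcore : ∀ b : Bool, ∑ j : Fin 20, (if X (slotEdge C (Sum.inl (b, j))).1 != X (slotEdge C (Sum.inl (b, j))).2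
      then (1 : ℝ) else 0) = gadgetCut (X ∘ gadgetEmb C.idx (XorRhs C) b) := by
    intro b
    have h1 : (gadgetCut (X ∘ gadgetEmb C.idx (XorRhs C) b) : ℝ) =
        ∑ e : {e // e ∈ gadgetEdges}, (if X (gadgetEmb C.idx (XorRhs C) b e.1.1) !=
          X (gadgetEmb C.idx (XorRhs C) b e.1.2) then (1 : ℝ) else 0) := by
      unfold gadgetCut
      rw [Finset.card_filter, Nat.cast_sum, ← Finset.sum_coe_sort]
      refine Fintype.sum_congr _ _ fun e => ?_
      simp only [Function.comp_apply]
      rcases Bool.eq_false_or_eq_true (X (gadgetEmb C.idx (XorRhs C) b e.1.1)) with h₁ | h₁ <;>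
        rcases Bool.eq_false_or_eq_true (X (gadgetEmb C.idx (XorRhs C) b e.1.2)) with h₂ | h₂ <;>
        simp [h₁, h₂]
    rw [h1]
    exact Fintype.sum_equiv gadgetEnum _ _ (fun j => rfl)
  rw [Fintype.sum_sum_type, Fintype.sum_prod_type, Fintype.sum_bool, hcore, hcore, htwo,
    cutValue_gadgetWeight, cutValue_gadgetWeight]
  cases XorRhs C <;> simp <;> ring

/-- **`𝔍*(y) = val_{𝔍*}(y ∘ numbering)/(42M)`:** the Max-CSP value of `𝔍*` is the normalised weighted cut
value of `MaxCutSdpHardness.cutInst`. [cite: BraunPokuttaRoy2016, §7 (arXiv v3)] -/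
theorem cutCsp_val (I : CSPInstance 3 n (literalClosure (xorK 3))) (y : Fin (cutVars n) → Bool) :
    (cutCsp I).val y = cutValue (cutInst I) (y ∘ vertexEquiv n) / (42 * I.M) := by
  unfold CSPInstance.val
  have hM : ((cutCsp I).M : ℝ) = 42 * I.M := by
    simp [cutCsp]; ring
  rw [hM, cutValue_cutInst]
  congr 1
  change ∑ p : Fin (I.M * 42), (if ((cutCsp I).cons p).sat y then (1 : ℝ) else 0) = _
  rw [Fintype.sum_equiv finProdFinEquiv.symm
    (fun p : Fin (I.M * 42) => if ((cutCsp I).cons p).sat y then (1 : ℝ) else 0)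
    (fun q : Fin I.M × Fin 42 => if (slotConstraint (I.cons q.1) (slotEquiv.symm q.2)).sat y then (1 : ℝ)
      else 0) (fun p => rfl), Fintype.sum_prod_type]
  refine Fintype.sum_congr _ _ fun i => ?_
  rw [← sum_slot_eq]
  rw [Fintype.sum_equiv slotEquiv.symm _
    (fun j : SlotIdx => if (slotConstraint (I.cons i) j).sat y then (1 : ℝ) else 0) (fun j => rfl)]
  rfl

/-- **Completeness: `𝔍*(x*) = (30 + 4·𝔍(x))/42`.** [cite: BraunPokuttaRoy2016, §7, proof of Thm. 7.1 (arXiv v3)] -/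
theorem cutCsp_val_cutAssign (I : CSPInstance 3 n (literalClosure (xorK 3))) (x : Fin n → Bool) :
    (cutCsp I).val (cutAssign x) = (30 + 4 * I.val x) / 42 := by
  rw [cutCsp_val]
  have hcomp : cutAssign x ∘ vertexEquiv n = canonSide x := by
    funext v; simp [cutAssign]
  rw [hcomp, cutValue_canonSide]
  have hM : (I.M : ℝ) ≠ 0 := by exact_mod_cast I.M_pos.ne'
  field_simp

/-- **Soundness: `opt(𝔍) ≤ s ⇒ opt(𝔍*) ≤ (15 + 2s)/21`.** [cite: BraunPokuttaRoy2016, §7, proof of Thm. 7.1 (arXiv v3)] -/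
theorem cutCsp_optLE (I : CSPInstance 3 n (literalClosure (xorK 3))) {s : ℝ} (hI : I.OptLE s) :
    (cutCsp I).OptLE ((15 + 2 * s) / 21) := by
  intro y
  rw [cutCsp_val]
  have hM : (0 : ℝ) < I.M := by exact_mod_cast I.M_pos
  rw [div_le_iff₀ (by positivity)]
  have := cutValue_le_of_optLE I hI (y ∘ vertexEquiv n)
  nlinarith

/-- The general value relation of the reduction, `𝔍(x) = (21/2)·𝔍*(x*) − 15/2`.
[cite: BraunPokuttaRoy2016, §7, proof of Thm. 7.1 (arXiv v3)] -/
theorem val_eq_cutCsp (I : CSPInstance 3 n (literalClosure (xorK 3))) (x : Fin n → Bool) :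
    I.val x = 21 / 2 * (cutCsp I).val (cutAssign x) + (-15 / 2) := by
  rw [cutCsp_val_cutAssign]; ring

/-- **The reduction Max-3-XOR → Max-Cut as a Braun–Pokutta–Roy reduction between the two Max-CSPs** (as
maximization problems with guarantees `(c, s)` resp. `((15+2c)/21, (15+2s)/21)`), affine with
`M₁ ≡ 21/2`, `M₂ = 0`. [cite: BraunPokuttaRoy2016, Def. 3.1 and §7 (arXiv v3)] -/
def xorCutCspReduction (n : ℕ) (c s : ℝ) :
    (cspProblem 3 n (literalClosure (xorK 3)) c s).Reduction
      (cspProblem 2 (cutVars n) maxCutPreds ((15 + 2 * c) / 21) ((15 + 2 * s) / 21)) :=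
  MaxProblem.Reduction.affine cutCsp cutAssign (fun _ => 21 / 2) (fun _ => 0) (fun _ => by norm_num)
    (fun _ => le_rfl)
    (fun I x => by simp only [cspProblem_C, cspProblem_val, cutCsp_val_cutAssign]; ring)
    (fun I hI => (cspProblem_sound_iff _).2 (cutCsp_optLE I ((cspProblem_sound_iff I).1 hI)))

/-! ### SDP: no small subspace achieves `((15+2c)/21, (15+2s)/21)` for Max-Cut (LRS Thm 1.5 shape) -/

/-- psd-rank transfer: a psd factorization of `M^{N,Cut}_{c',s'}` of size `r` gives one of
`M^{n,3XOR}_{c,s}` of size `r + 1`. [cite: BraunPokuttaRoy2016, Thm. 3.2 (arXiv v3)] -/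
theorem hasPsdFactorization_xor_of_cut {c s : ℝ} {r : ℕ}
    (h : HasPsdFactorization (cspMatrix 2 (cutVars n) maxCutPreds ((15 + 2 * c) / 21) ((15 + 2 * s) / 21)) r) :
    HasPsdFactorization (cspMatrix 3 n (literalClosure (xorK 3)) c s) (r + 1) :=
  hasPsdFactorization_cspProblem_iff.1 ((xorCutCspReduction n c s).hasPsdFactorization_slackMatrix_affine
    (fun _ => 21 / 2) (fun _ => 0) (fun _ _ => rfl) (fun _ _ => rfl) (hasPsdFactorization_cspProblem_iff.2 h))

/-- Asymptotic transfer `N = 1 + 2n + 36n³`: for `n ≥ 37`, `N^{γ/16 · log N/log log N} ≤ n^{γ log n/log log n}`.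
[folklore] -/
private theorem rpow_cutVars_le {n : ℕ} (hn : 37 ≤ n) {γ : ℝ} (hγ : 0 ≤ γ) :
    ((cutVars n : ℕ) : ℝ) ^ (γ / 16 * Real.log (cutVars n) / Real.log (Real.log (cutVars n))) ≤
      (n : ℝ) ^ (γ * Real.log n / Real.log (Real.log n)) := by
  rw [cutVars_eq]
  set N : ℕ := 1 + 2 * n + 36 * n ^ 3 with hN
  have hn0 : (0 : ℝ) < n := by exact_mod_cast lt_of_lt_of_le (by norm_num) hn
  have hn37 : (37 : ℝ) ≤ n := by exact_mod_cast hn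
  have hn3 : (0 : ℝ) ≤ (n : ℝ) ^ 3 := by positivity
  have hnN : (n : ℝ) ≤ N := by rw [hN]; push_cast; linarith
  have hN0 : (0 : ℝ) < N := lt_of_lt_of_le hn0 hnN
  have hNle : (N : ℝ) ≤ (n : ℝ) ^ (4 : ℕ) := by
    rw [hN]; push_cast
    have h4 : (n : ℝ) ^ 4 = n * n ^ 3 := by ring
    have h37 : 37 * (n : ℝ) ^ 3 ≤ n * n ^ 3 := mul_le_mul_of_nonneg_right hn37 hn3
    have hsq : (37 : ℝ) * 37 ≤ (n : ℝ) ^ 2 := by nlinarith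
    have hcube : (2 : ℝ) * n + 1 ≤ (n : ℝ) ^ 3 := by nlinarith
    rw [h4]; linarith
  have hlogn : 1 < Real.log n := by
    rw [← Real.exp_lt_exp, Real.exp_log hn0]
    exact lt_of_lt_of_le (lt_trans Real.exp_one_lt_d9 (by norm_num)) hn37
  have hlogN_le : Real.log N ≤ 4 * Real.log n := by
    have h4 : Real.log ((n : ℝ) ^ (4 : ℕ)) = 4 * Real.log n := by
      rw [Real.log_pow]; norm_num
    rw [← h4]
    exact Real.log_le_log hN0 hNle
  have hlogN_ge : Real.log n ≤ Real.log N := Real.log_le_log hn0 hnN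
  have hllN_ge : Real.log (Real.log n) ≤ Real.log (Real.log N) :=
    Real.log_le_log (by linarith) hlogN_ge
  have hlln : 0 < Real.log (Real.log n) := Real.log_pos hlogn
  have hllN : 0 < Real.log (Real.log N) := lt_of_lt_of_le hlln hllN_ge
  rw [Real.rpow_def_of_pos hN0, Real.rpow_def_of_pos hn0]
  apply Real.exp_le_exp.2
  have key : Real.log N * (γ / 16 * Real.log N / Real.log (Real.log N)) =
      γ / 16 * (Real.log N) ^ 2 / Real.log (Real.log N) := by ring
  have key' : Real.log n * (γ * Real.log n / Real.log (Real.log n)) =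
      γ * (Real.log n) ^ 2 / Real.log (Real.log n) := by ring
  rw [key, key']
  have hsq : (Real.log N) ^ 2 ≤ 16 * (Real.log n) ^ 2 := by
    have h0 : 0 ≤ Real.log N := le_trans (by linarith) hlogN_ge
    nlinarith
  calc γ / 16 * Real.log ↑N ^ 2 / Real.log (Real.log ↑N)
      ≤ γ / 16 * (16 * Real.log ↑n ^ 2) / Real.log (Real.log ↑N) := by gcongr
    _ = γ * Real.log ↑n ^ 2 / Real.log (Real.log ↑N) := by ring
    _ ≤ γ * Real.log ↑n ^ 2 / Real.log (Real.log ↑n) := by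
        apply div_le_div_of_nonneg_left (by positivity) hlln hllN_ge

/-- Bookkeeping: for `n ≥ 16`, `n^{α/3} ≥ 9` and `r ≤ n^{(α/3) log n/log log n}`: `(r+1)² ≤ n^{α log n/log log n}`.
[folklore] -/
private theorem sq_succ_le' {n r : ℕ} (hn : 16 ≤ n) {α : ℝ} (hα : 0 < α) (h9 : (9 : ℝ) ≤ (n : ℝ) ^ (α / 3))
    (hr : (r : ℝ) ≤ (n : ℝ) ^ (α / 3 * Real.log n / Real.log (Real.log n))) :
    (((r + 1) ^ 2 : ℕ) : ℝ) ≤ (n : ℝ) ^ (α * Real.log n / Real.log (Real.log n)) := by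
  have hn0 : (0 : ℝ) < n := by exact_mod_cast lt_of_lt_of_le (by norm_num) hn
  have hn1 : (1 : ℝ) < n := by exact_mod_cast lt_of_lt_of_le (by norm_num) hn
  have hlog : 1 < Real.log n := by
    rw [← Real.exp_lt_exp, Real.exp_log hn0]
    exact lt_of_lt_of_le (lt_trans Real.exp_one_lt_d9 (by norm_num)) (by exact_mod_cast hn : (16 : ℝ) ≤ n)
  have hll : 0 < Real.log (Real.log n) := Real.log_pos hlog
  have hll_le : Real.log (Real.log n) ≤ Real.log n :=
    (Real.log_le_sub_one_of_pos (by linarith)).trans (by linarith)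
  set L : ℝ := Real.log n / Real.log (Real.log n) with hL
  have hL1 : 1 ≤ L := by rw [hL, le_div_iff₀ hll, one_mul]; exact hll_le
  have hexp : ∀ b : ℝ, b * Real.log n / Real.log (Real.log n) = b * L := fun b => by rw [hL]; ring
  rw [hexp] at hr ⊢
  have hmono : ∀ b : ℝ, 0 ≤ b → (n : ℝ) ^ b ≤ (n : ℝ) ^ (b * L) := fun b hb =>
    Real.rpow_le_rpow_of_exponent_le hn1.le (by nlinarith)
  have hthird : (9 : ℝ) ≤ (n : ℝ) ^ (α / 3 * L) := h9.trans (hmono _ (by positivity))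
  have hr2 : ((r : ℝ) + 1) ≤ 3 * (n : ℝ) ^ (α / 3 * L) := by linarith
  push_cast
  calc ((r : ℝ) + 1) ^ 2 ≤ (3 * (n : ℝ) ^ (α / 3 * L)) ^ 2 := pow_le_pow_left₀ (by positivity) hr2 2
    _ = 9 * ((n : ℝ) ^ (α / 3 * L) * (n : ℝ) ^ (α / 3 * L)) := by ring
    _ ≤ (n : ℝ) ^ (α / 3 * L) * ((n : ℝ) ^ (α / 3 * L) * (n : ℝ) ^ (α / 3 * L)) := by gcongr
    _ = (n : ℝ) ^ (α * L) := by
        rw [← Real.rpow_add hn0, ← Real.rpow_add hn0]; ring_nf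

/-- **Max-Cut: no SDP relaxation of size `N^{γ log N/log log N}` achieves `((15+2c)/21, (15+2s)/21)`**
(Lee–Raghavendra–Steurer Thm. 1.5 shape, PROVED): there is `γ > 0` such that for all `1/2 < s < c < 1` and
all large `n`, with `N = 1 + 2n + 36n³`, no subspace `U` of functions on `{0,1}^N` with
`dim U ≤ N^{γ log N/log log N}` achieves a `((15+2c)/21, (15+2s)/21)`-approximation for Max-Cut on `N`
variables. [cite: BraunPokuttaRoy2016, Thm. 7.1 (arXiv v3; constants repaired, see `MaxCutSdpHardness`)]
[cite: LeeRaghavendraSteurer2015, Thm. 1.5 and Prop. 1.13 (p. 6, 8)] [cite: TrevisanEtAl2000, Lemma 4.3] -/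
theorem maxCut_subspace_quasipoly :
    ∃ γ : ℝ, 0 < γ ∧ ∀ s : ℝ, 1 / 2 < s → ∀ c : ℝ, s < c → c < 1 →
      ∃ n₀ : ℕ, ∀ n : ℕ, n₀ ≤ n → ∀ U : Submodule ℝ ((Fin (cutVars n) → Bool) → ℝ),
        (Module.finrank ℝ U : ℝ) ≤ ((cutVars n : ℕ) : ℝ) ^
          (γ * Real.log (cutVars n) / Real.log (Real.log (cutVars n))) →
        ¬ AchievesApprox maxCutPreds (U : Set ((Fin (cutVars n) → Bool) → ℝ))
          ((15 + 2 * c) / 21) ((15 + 2 * s) / 21) := by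
  obtain ⟨α, hα, H⟩ := LeeRaghavendraSteurer2015_maxKXor_quasipoly (k := 3) le_rfl
  refine ⟨α / 3 / 16, by positivity, fun s hs c hsc hc1 => ?_⟩
  obtain ⟨n₀, Hn⟩ := H s hs c hsc hc1
  obtain ⟨n₁, hn₁⟩ : ∃ n₁ : ℕ, ∀ n : ℕ, n₁ ≤ n → (9 : ℝ) ≤ (n : ℝ) ^ (α / 3) := by
    have ht : Tendsto (fun n : ℕ => (n : ℝ) ^ (α / 3)) atTop atTop :=
      (tendsto_rpow_atTop (by positivity)).comp tendsto_natCast_atTop_atTop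
    obtain ⟨n₁, hn₁⟩ := eventually_atTop.1 (ht.eventually_ge_atTop 9)
    exact ⟨n₁, hn₁⟩
  refine ⟨max (max n₀ 37) n₁, fun n hn U hU hA => ?_⟩
  have hn₀ : n₀ ≤ n := le_trans (le_max_left _ _) (le_trans (le_max_left _ _) hn)
  have hn37 : 37 ≤ n := le_trans (le_max_right _ _) (le_trans (le_max_left _ _) hn)
  have hnn₁ : n₁ ≤ n := le_trans (le_max_right _ _) hn
  -- `U` achieving ⇒ psd factorization of the Max-Cut matrix of size `dim U` ⇒ of the XOR matrix, size `dim U + 1`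
  have hpsd := hasPsdFactorization_xor_of_cut (AchievesApprox.hasPsdFactorization U hA)
  obtain ⟨U', hU', hdim⟩ := hpsd.exists_achievesApprox
  refine Hn n hn₀ U' ?_ hU'
  have hr : (Module.finrank ℝ U : ℝ) ≤ (n : ℝ) ^ (α / 3 * Real.log n / Real.log (Real.log n)) :=
    hU.trans (rpow_cutVars_le hn37 (by positivity))
  exact le_trans (by exact_mod_cast hdim) (sq_succ_le' (le_trans (by norm_num) hn37) hα (hn₁ n hnn₁) hr)

/-! ### LP: polynomial-size LP relaxations of Max-Cut do not achieve `((17−2ε)/21, (16+2ε)/21)` (unconditional) -/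

/-- **Pull-back to Max-3-XOR:** an LP relaxation of Max-Cut on `N = 1 + 2n + 36n³` variables of size `R`
achieving `((15+2c)/21, (15+2s)/21)` yields an LP relaxation of Max-3-XOR on `n` variables of size `R + 2`
achieving `(c, s)`. [cite: BraunPokuttaZink2015, Prop. 4.2 (LP clause)] [cite: BraunPokuttaRoy2016, §7 (arXiv v3)] -/
theorem LPRelaxation.xor_of_cut {R : ℕ} {c s : ℝ} (L : LPRelaxation 2 (cutVars n) maxCutPreds R)
    (hL : L.Achieves ((15 + 2 * c) / 21) ((15 + 2 * s) / 21)) :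
    ∃ L' : LPRelaxation 3 n (literalClosure (xorK 3)) (R + 2), L'.Achieves c s :=
  ⟨L.pullback cutCsp cutAssign (21 / 2) (-15 / 2) val_eq_cutCsp,
    hL.pullback (by norm_num) (by ring_nf; exact le_rfl) fun I hI => cutCsp_optLE I hI⟩

/-- **Max-Cut: polynomial-size LPs do not achieve `((17 − 2ε)/21, (16 + 2ε)/21)` — UNCONDITIONAL.** For
every `ε > 0` and every exponent `C`, for all large `n`, with `N = 1 + 2n + 36n³`: no LP relaxation
(Kothari–Meka–Raghavendra Def. 1.1) of Max-Cut on `N` variables of size `≤ N^C` achieves a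
`((17 − 2ε)/21, (16 + 2ε)/21)`-approximation (ratio `→ 16/17`).  Inputs: the tree's `maxKXor_poly_lp`
(Chan–Lee–Raghavendra–Steurer Thm. 3.1 × Schoenebeck: poly-size LPs do not `(1−ε, 1/2+ε)`-approximate
Max-3-XOR) and the gadget reduction.  (The tree's `maxCut_poly_lp_of_CMM` gives `(1 − ε, 1/2 + ε)`
conditionally on the Charikar–Makarychev–Makarychev Sherali–Adams gap.)
[cite: BraunPokuttaZink2015, Thm. 4.5 (MaxCUT clause; here the weaker gadget constant, without [CMM09])]
[cite: ChanEtAl2016, Thm. 3.1] [cite: TrevisanEtAl2000, Lemma 4.3] -/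
theorem maxCut_poly_lp {ε : ℝ} (hε : 0 < ε) (C : ℕ) :
    ∃ n₀ : ℕ, ∀ n : ℕ, n₀ ≤ n → ∀ R : ℕ, (R : ℝ) ≤ ((cutVars n : ℕ) : ℝ) ^ C →
      ∀ L : LPRelaxation 2 (cutVars n) maxCutPreds R,
        ¬ L.Achieves ((17 - 2 * ε) / 21) ((16 + 2 * ε) / 21) := by
  -- Max-3-XOR: no LP of size `≤ n^{(8C+4)/2} = n^{4C+2}` achieves `(1−ε, 1/2+ε)`
  obtain ⟨n₀, H⟩ := maxKXor_poly_lp (k := 3) le_rfl hε (d := 8 * C + 4) (by omega)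
  refine ⟨max n₀ 37, fun n hn R hR L hL => ?_⟩
  have hn₀ : n₀ ≤ n := le_trans (le_max_left _ _) hn
  have hn37 : 37 ≤ n := le_trans (le_max_right _ _) hn
  have h1 : (15 + 2 * (1 - ε)) / 21 = (17 - 2 * ε) / 21 := by ring
  have h2 : (15 + 2 * (1 / 2 + ε)) / 21 = (16 + 2 * ε) / 21 := by ring
  rw [← h1, ← h2] at hL
  obtain ⟨L', hL'⟩ := L.xor_of_cut hL
  refine H n hn₀ (R + 2) ?_ L' hL'
  -- `R + 2 ≤ N^C + 2 ≤ n^{4C} + 2 ≤ n^{4C+2}`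
  have hn0 : (0 : ℝ) < n := by exact_mod_cast lt_of_lt_of_le (by norm_num) hn37
  have hn2 : (2 : ℝ) ≤ n := by exact_mod_cast le_trans (by norm_num) hn37
  have hn3 : (0 : ℝ) ≤ (n : ℝ) ^ 3 := by positivity
  have hN : ((cutVars n : ℕ) : ℝ) ≤ (n : ℝ) ^ 4 := by
    rw [cutVars_eq]; push_cast
    have hn37' : (37 : ℝ) ≤ n := by exact_mod_cast hn37
    have h4 : (n : ℝ) ^ 4 = n * n ^ 3 := by ring
    have h37 : 37 * (n : ℝ) ^ 3 ≤ n * n ^ 3 := mul_le_mul_of_nonneg_right hn37' hn3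
    have hsq : (37 : ℝ) * 37 ≤ (n : ℝ) ^ 2 := by nlinarith
    have hcube : (2 : ℝ) * n + 1 ≤ (n : ℝ) ^ 3 := by nlinarith
    rw [h4]; linarith
  have hexp : (((8 * C + 4 : ℕ) : ℝ) / 2) = ((4 * C + 2 : ℕ) : ℝ) := by push_cast; ring
  rw [hexp, Real.rpow_natCast]
  have hRC : (R : ℝ) ≤ (n : ℝ) ^ (4 * C) := by
    refine hR.trans ?_
    calc ((cutVars n : ℕ) : ℝ) ^ C ≤ ((n : ℝ) ^ 4) ^ C := pow_le_pow_left₀ (by positivity) hN C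
      _ = (n : ℝ) ^ (4 * C) := by rw [← pow_mul]
  have hpow1 : (1 : ℝ) ≤ (n : ℝ) ^ (4 * C) := one_le_pow₀ (by linarith)
  have hn4 : (4 : ℝ) ≤ (n : ℝ) ^ 2 := by nlinarith
  have hkey : (n : ℝ) ^ (4 * C) * 4 ≤ (n : ℝ) ^ (4 * C) * (n : ℝ) ^ 2 :=
    mul_le_mul_of_nonneg_left hn4 (by positivity)
  push_cast
  calc (R : ℝ) + 2 ≤ (n : ℝ) ^ (4 * C) + 2 := by linarith
    _ ≤ (n : ℝ) ^ (4 * C) * (n : ℝ) ^ 2 := by linarith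
    _ = (n : ℝ) ^ (4 * C + 2) := by rw [← pow_add]

/-- **Max-Cut: polynomial-size LPs have integrality gap at least `17/16 − ε` — UNCONDITIONAL.** For every
`ε > 0` and `C`, for all large `n`, no LP relaxation of Max-Cut on `N = 1 + 2n + 36n³` variables of size
`≤ N^C` has integrality gap `< 17/16 − ε`. [cite: BraunPokuttaZink2015, Thm. 4.5 (MaxCUT clause; weaker
gadget constant, without [CMM09])] [cite: KothariMekaRaghavendra2017, Cor. 1.5 (Max-Cut clause shape)] -/
theorem maxCut_poly_lpGap {ε : ℝ} (hε : 0 < ε) (C : ℕ) :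
    ∃ n₀ : ℕ, ∀ n : ℕ, n₀ ≤ n → ∀ R : ℕ, (R : ℝ) ≤ ((cutVars n : ℕ) : ℝ) ^ C →
      ∀ L : LPRelaxation 2 (cutVars n) maxCutPreds R, ¬ L.GapLT (17 / 16 - ε) := by
  -- margin `ε' = min ε 1 / 4`: `(17/16 − ε)(16 + 2ε')/21 ≤ (17 − 2ε')/21`
  set ε' : ℝ := min ε 1 / 4 with hε'
  have hε'0 : 0 < ε' := by rw [hε']; exact div_pos (lt_min hε one_pos) (by norm_num)
  have hε'ε : ε' ≤ ε / 4 := by rw [hε']; exact div_le_div_of_nonneg_right (min_le_left _ _) (by norm_num)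
  have hε'1 : ε' ≤ 1 / 4 := by rw [hε']; exact div_le_div_of_nonneg_right (min_le_right _ _) (by norm_num)
  obtain ⟨n₀, H⟩ := maxCut_poly_lp hε'0 C
  refine ⟨n₀, fun n hn R hR L hgap => H n hn R hR L ?_⟩
  refine hgap.achieves (by positivity) ?_ (by linarith)
  nlinarith

end Instance

end Literature.Combinatorics.Optimization

end
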